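import Literature.Probability.Percolation.TriDiscShelling
import Literature.Probability.Percolation.OneArmLSW
import HarnessLib

/-!
# Rounding to the triangular lattice; sites near a curve are connected

Topic `Literature/Probability/Percolation`; family `crit-perc`. Metric facts linking the plane
to the mesh `δ𝕋` (`triMeshPoint δ`), for the discretisation of planar domains and curves
(Bollobás–Riordan, *Percolation* (2006), Ch. 7 §7.2.5, proof of Lemma 14, e.g. Claim 18 p. 191:
"`P^{(3δ)} ⊆ D⁻` contains a path of hexagons joining `z₀` to `x'`"):

* `eq_zero_or_exists_triDir_of_norm_lt` — a lattice vector of Euclidean norm `< √3` is `0` or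
  one of the six unit directions (the norm form `x₀² + x₀x₁ + x₁²` does not represent `2`);
  `eq_or_adj_of_dist_triMeshPoint_lt` — mesh points at distance `< √3 δ` are equal or adjacent;
* `exists_dist_triMeshPoint_le` — **every point of the plane is within `0.7 δ` of a mesh point**
  (rounding in the coordinates `u + v ζ`; the covering radius is `1/√3`): `normForm_corner_le`,
  `norm_add_mul_triZeta_sq`;
* `pathIn_near_path` — **the sites within `0.7 δ` of a continuous curve are joined by lattice
  paths through such sites** (uniform continuity + rounding: consecutive rounded sites are
  within `√3 δ`).

## References

* B. Bollobás, O. Riordan, *Percolation*, Cambridge University Press (2006), Ch. 7 §7.2.5,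
  Claim 18 p. 191.

## Mathlib / tree

Mathlib: `CompactSpace.uniformContinuous_of_continuous`, `Set.projIcc`, `Nat.floor`. Tree:
`OneArmLSW.lean` (`norm_triEmbed_sq`, `triEmbed_re/im`), `TriDiscShelling.lean`
(`triDir`, `triGraph_adj_iff_triDir`), `SitePaths.lean` (`PathIn`).
-/

noncomputable section

open Literature.Probability.LatticeModels

namespace Literature.Probability.Percolation

/-! ### Small norms: zero or a unit -/

/-- **A lattice vector of norm `< √3` is zero or one of the six unit directions**: the norm form
`x₀² + x₀x₁ + x₁²` is an integer `< 3`, and it does not take the value `2`. [folklore] -/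
theorem eq_zero_or_exists_triDir_of_norm_lt {v : Site 2} (h : ‖triEmbed v‖ < Real.sqrt 3) :
    v = 0 ∨ ∃ j, v = triDir j := by
  have hsq : ‖triEmbed v‖ ^ 2 < 3 := by
    have h3 : Real.sqrt 3 ^ 2 = 3 := Real.sq_sqrt (by norm_num)
    nlinarith [norm_nonneg (triEmbed v), Real.sqrt_nonneg 3]
  rw [norm_triEmbed_sq] at hsq
  have hN : v 0 ^ 2 + v 0 * v 1 + v 1 ^ 2 < 3 := by exact_mod_cast hsq
  have h0 : v 0 ≤ 1 ∧ -1 ≤ v 0 := by constructor <;> nlinarith [sq_nonneg (v 0 + v 1), sq_nonneg (v 1), sq_nonneg (v 0)]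
  have h1 : v 1 ≤ 1 ∧ -1 ≤ v 1 := by constructor <;> nlinarith [sq_nonneg (v 0 + v 1), sq_nonneg (v 1), sq_nonneg (v 0)]
  have key : ∀ a b : ℤ, a ≤ 1 → -1 ≤ a → b ≤ 1 → -1 ≤ b → a ^ 2 + a * b + b ^ 2 < 3 →
      (a = 0 ∧ b = 0) ∨ (a = 1 ∧ b = 0) ∨ (a = 0 ∧ b = 1) ∨ (a = -1 ∧ b = 1) ∨ (a = -1 ∧ b = 0) ∨
        (a = 0 ∧ b = -1) ∨ (a = 1 ∧ b = -1) := by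
    intro a b ha ha' hb hb' hab
    interval_cases a <;> interval_cases b <;> simp_all
  rcases key (v 0) (v 1) h0.1 h0.2 h1.1 h1.2 hN with ⟨ha, hb⟩ | ⟨ha, hb⟩ | ⟨ha, hb⟩ | ⟨ha, hb⟩ | ⟨ha, hb⟩ | ⟨ha, hb⟩ | ⟨ha, hb⟩
  · left; ext i; fin_cases i <;> simp [ha, hb]
  · right; refine ⟨0, ?_⟩; ext i; fin_cases i <;> simp [ha, hb, triDir]
  · right; refine ⟨1, ?_⟩; ext i; fin_cases i <;> simp [ha, hb, triDir]
  · right; refine ⟨2, ?_⟩; ext i; fin_cases i <;> simp [ha, hb, triDir]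
  · right; refine ⟨3, ?_⟩; ext i; fin_cases i <;> simp [ha, hb, triDir]
  · right; refine ⟨4, ?_⟩; ext i; fin_cases i <;> simp [ha, hb, triDir]
  · right; refine ⟨5, ?_⟩; ext i; fin_cases i <;> simp [ha, hb, triDir]

/-- **Mesh points at distance `< √3 δ` are equal or adjacent.** [folklore] -/
theorem eq_or_adj_of_dist_triMeshPoint_lt {δ : ℝ} (hδ : 0 < δ) {a b : Site 2}
    (h : dist (triMeshPoint δ a) (triMeshPoint δ b) < Real.sqrt 3 * δ) : a = b ∨ triGraph.Adj a b := by
  have hn : ‖triEmbed (b - a)‖ < Real.sqrt 3 := by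
    have e : triMeshPoint δ b - triMeshPoint δ a = (δ : ℂ) * triEmbed (b - a) := by
      rw [triMeshPoint, triMeshPoint, ← mul_sub, ← triEmbed_sub]
    rw [dist_comm, dist_eq_norm, e, norm_mul, Complex.norm_real, Real.norm_eq_abs, abs_of_pos hδ] at h
    nlinarith [norm_nonneg (triEmbed (b - a))]
  rcases eq_zero_or_exists_triDir_of_norm_lt hn with h0 | ⟨j, hj⟩
  · exact Or.inl (sub_eq_zero.1 h0).symm
  · right
    rw [triGraph_adj_iff_triDir]
    exact ⟨j, by rw [← hj, add_sub_cancel]⟩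

/-! ### Rounding a point of the plane to a nearby site -/

/-- In the unit rhombus `{s + t ζ : 0 ≤ s, t < 1}` every point is within `0.7` (in the norm
`x² + xy + y²` of `x + y ζ`) of one of the four corners. [folklore] -/
theorem normForm_corner_le (s t : ℝ) (hs : 0 ≤ s) (hs1 : s < 1) (ht : 0 ≤ t) (ht1 : t < 1) :
    ∃ i j : ℤ, (s - i) ^ 2 + (s - i) * (t - j) + (t - j) ^ 2 ≤ 49 / 100 := by
  by_cases h1 : s + t ≤ 7 / 10
  · exact ⟨0, 0, by push_cast; nlinarith⟩
  by_cases h2 : s + t ≤ 1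
  · by_cases h3 : t ≤ s
    · refine ⟨1, 0, ?_⟩; push_cast; nlinarith
    · refine ⟨0, 1, ?_⟩; push_cast; nlinarith
  by_cases h4 : (1 - s) + (1 - t) ≤ 7 / 10
  · exact ⟨1, 1, by push_cast; nlinarith⟩
  by_cases h3 : 1 - t ≤ 1 - s
  · refine ⟨0, 1, ?_⟩; push_cast; nlinarith
  · refine ⟨1, 0, ?_⟩; push_cast; nlinarith

/-- The Euclidean norm of `x + y ζ` for real `x, y` is the norm form. [folklore] -/
theorem norm_add_mul_triZeta_sq (x y : ℝ) : ‖(x : ℂ) + (y : ℂ) * triZeta‖ ^ 2 = x ^ 2 + x * y + y ^ 2 := by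
  rw [Complex.sq_norm, Complex.normSq_apply]
  simp only [Complex.add_re, Complex.ofReal_re, Complex.mul_re, triZeta_re, Complex.ofReal_im, triZeta_im,
    zero_mul, sub_zero, Complex.add_im, Complex.mul_im, zero_add, add_zero]
  have h3 : Real.sqrt 3 * Real.sqrt 3 = 3 := Real.mul_self_sqrt (by norm_num)
  nlinarith [h3]

/-- **Every point of the plane is within `0.7 δ` of a mesh point of `δ𝕋`** (the covering radius
of the triangular lattice is `1/√3 ≈ 0.577`). [folklore] -/
theorem exists_dist_triMeshPoint_le {δ : ℝ} (hδ : 0 < δ) (z : ℂ) :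
    ∃ a : Site 2, dist z (triMeshPoint δ a) ≤ 7 / 10 * δ := by
  have h3pos : 0 < Real.sqrt 3 := Real.sqrt_pos.2 (by norm_num)
  set u : ℝ := z.re / δ - z.im / (δ * Real.sqrt 3) with hu
  set v : ℝ := 2 * z.im / (δ * Real.sqrt 3) with hv
  obtain ⟨i, j, hij⟩ := normForm_corner_le (u - ⌊u⌋) (v - ⌊v⌋) (by linarith [Int.floor_le u])
    (by linarith [Int.lt_floor_add_one u]) (by linarith [Int.floor_le v]) (by linarith [Int.lt_floor_add_one v])
  refine ⟨fun k => ![⌊u⌋ + i, ⌊v⌋ + j] k, ?_⟩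
  -- `z - δ a = δ ((u - ⌊u⌋ - i) + (v - ⌊v⌋ - j) ζ)`
  have hz : z = (δ : ℂ) * ((u : ℂ) + (v : ℂ) * triZeta) := by
    apply Complex.ext
    · simp only [Complex.mul_re, Complex.ofReal_re, Complex.ofReal_im, Complex.add_re, Complex.mul_im, triZeta_re,
        triZeta_im, zero_mul, sub_zero, Complex.add_im, add_zero, zero_add]
      rw [hu, hv]; field_simp; ring
    · simp only [Complex.mul_im, Complex.ofReal_re, Complex.ofReal_im, Complex.add_re, Complex.mul_re, triZeta_re,
        triZeta_im, zero_mul, sub_zero, Complex.add_im, add_zero, zero_add]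
      rw [hv]; field_simp
  have he : z - triMeshPoint δ (fun k => ![⌊u⌋ + i, ⌊v⌋ + j] k) =
      (δ : ℂ) * (((u - ⌊u⌋ - i : ℝ) : ℂ) + ((v - ⌊v⌋ - j : ℝ) : ℂ) * triZeta) := by
    rw [triMeshPoint, triEmbed, hz]
    simp only [Matrix.cons_val_zero, Matrix.cons_val_one]
    push_cast
    ring
  rw [dist_eq_norm, he, norm_mul, Complex.norm_real, Real.norm_eq_abs, abs_of_pos hδ]
  have hn : ‖((u - ⌊u⌋ - i : ℝ) : ℂ) + ((v - ⌊v⌋ - j : ℝ) : ℂ) * triZeta‖ ≤ 7 / 10 := by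
    have hsq := norm_add_mul_triZeta_sq (u - ⌊u⌋ - i) (v - ⌊v⌋ - j)
    have hle : ‖((u - ⌊u⌋ - i : ℝ) : ℂ) + ((v - ⌊v⌋ - j : ℝ) : ℂ) * triZeta‖ ^ 2 ≤ (7 / 10) ^ 2 := by
      rw [hsq]; nlinarith [hij]
    exact (sq_le_sq₀ (norm_nonneg _) (by norm_num)).1 hle
  nlinarith [hn, norm_nonneg (((u - ⌊u⌋ - i : ℝ) : ℂ) + ((v - ⌊v⌋ - j : ℝ) : ℂ) * triZeta)]

/-! ### Sites near a curve are connected -/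

/-- **The sites within `0.7 δ` of a continuous curve form a connected set of `𝕋`**: any two of
them are joined by a lattice path through such sites (discretise the curve finely by uniform
continuity and round each point; consecutive rounded sites are within `√3 δ`, hence equal or
adjacent). [folklore] -/
theorem pathIn_near_path {δ : ℝ} (hδ : 0 < δ) {x y : ℂ} (γ : Path x y) {c c' : Site 2}
    (hc : ∃ t, dist (γ t) (triMeshPoint δ c) ≤ 7 / 10 * δ) (hc' : ∃ t, dist (γ t) (triMeshPoint δ c') ≤ 7 / 10 * δ) :
    PathIn triGraph {e : Site 2 | ∃ t, dist (γ t) (triMeshPoint δ e) ≤ 7 / 10 * δ} c c' := by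
  classical
  set N : Set (Site 2) := {e | ∃ t, dist (γ t) (triMeshPoint δ e) ≤ 7 / 10 * δ} with hN
  -- the slack `κ = √3 - 1.4 > 0`
  have h3 : (17 : ℝ) / 10 < Real.sqrt 3 := by
    rw [show (17 : ℝ) / 10 = Real.sqrt ((17 / 10) ^ 2) by rw [Real.sqrt_sq (by norm_num)]]
    exact Real.sqrt_lt_sqrt (by norm_num) (by norm_num)
  set κ : ℝ := Real.sqrt 3 - 14 / 10 with hκ
  have hκ0 : 0 < κ := by rw [hκ]; linarith
  have hκpos : 0 < κ * δ := by positivity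
  -- uniform continuity of the curve
  obtain ⟨θ, hθ, hmod⟩ := Metric.uniformContinuous_iff.1
    (CompactSpace.uniformContinuous_of_continuous γ.continuous) (κ * δ) hκpos
  obtain ⟨n, hn⟩ := exists_nat_gt (1 / θ)
  have hnpos : 0 < n := by
    have : (0 : ℝ) < n := lt_trans (by positivity) hn
    exact_mod_cast this
  have hn' : 1 / (n : ℝ) < θ := by
    rw [div_lt_iff₀ (by exact_mod_cast hnpos)]; rw [div_lt_iff₀ hθ] at hn; linarith
  -- partition points and rounded sites
  set pt : ℕ → unitInterval := fun k => Set.projIcc 0 1 zero_le_one ((k : ℝ) / n) with hpt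
  have hptval : ∀ k, k ≤ n → ((pt k : unitInterval) : ℝ) = k / n := by
    intro k hk
    rw [hpt]
    simp only
    rw [Set.projIcc_of_mem]
    exact ⟨by positivity, div_le_one_of_le₀ (by exact_mod_cast hk) (by positivity)⟩
  have hround : ∀ k, ∃ a : Site 2, dist (γ (pt k)) (triMeshPoint δ a) ≤ 7 / 10 * δ := fun k =>
    exists_dist_triMeshPoint_le hδ _
  choose a ha using hround
  have haN : ∀ k, a k ∈ N := fun k => ⟨pt k, ha k⟩
  -- two sites of `N` whose curve points are `< κδ` apart are equal or adjacent
  have hlink : ∀ {e e' : Site 2} {t t' : unitInterval}, dist (γ t) (triMeshPoint δ e) ≤ 7 / 10 * δ →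
      dist (γ t') (triMeshPoint δ e') ≤ 7 / 10 * δ → dist (γ t) (γ t') < κ * δ → e = e' ∨ triGraph.Adj e e' := by
    intro e e' t t' he he' htt
    refine eq_or_adj_of_dist_triMeshPoint_lt hδ ?_
    calc dist (triMeshPoint δ e) (triMeshPoint δ e')
        ≤ dist (triMeshPoint δ e) (γ t) + dist (γ t) (γ t') + dist (γ t') (triMeshPoint δ e') := dist_triangle4 _ _ _ _
      _ < 7 / 10 * δ + κ * δ + 7 / 10 * δ := by rw [dist_comm] at he; linarith
      _ = Real.sqrt 3 * δ := by rw [hκ]; ring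
  -- consecutive rounded sites are linked
  have hchain : ∀ k, k ≤ n → PathIn triGraph N (a 0) (a k) := by
    intro k
    induction k with
    | zero => intro _; exact PathIn.refl (haN 0)
    | succ k ih =>
      intro hk
      have hd : dist (γ (pt k)) (γ (pt (k + 1))) < κ * δ := by
        apply hmod
        rw [Subtype.dist_eq, hptval k (by omega), hptval (k + 1) hk, Real.dist_eq]
        have e : |(k : ℝ) / n - ((k + 1 : ℕ) : ℝ) / n| = 1 / n := by
          push_cast
          rw [show (k : ℝ) / n - ((k : ℝ) + 1) / n = -(1 / n) by ring, abs_neg, abs_of_pos (by positivity)]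
        rw [e]; exact hn'
      rcases hlink (ha k) (ha (k + 1)) hd with e | hadj
      · rw [← e]; exact ih (by omega)
      · exact (ih (by omega)).tail hadj (haN _)
  -- every site of `N` is linked to a rounded site
  have hto : ∀ e ∈ N, PathIn triGraph N e (a 0) := by
    rintro e ⟨t, ht⟩
    set k := ⌊(t : ℝ) * n⌋₊ with hk
    have ht0 : 0 ≤ (t : ℝ) := t.2.1
    have ht1 : (t : ℝ) ≤ 1 := t.2.2
    have hkn : k ≤ n := by
      rw [hk]; apply Nat.floor_le_of_le
      calc (t : ℝ) * n ≤ 1 * n := by gcongr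
        _ = n := one_mul _
    have hkt : dist t (pt k) < θ := by
      rw [Subtype.dist_eq, hptval k hkn, Real.dist_eq]
      have hnr : (0 : ℝ) < n := by exact_mod_cast hnpos
      have h1 : (k : ℝ) ≤ (t : ℝ) * n := Nat.floor_le (by positivity)
      have h2 : (t : ℝ) * n < k + 1 := Nat.lt_floor_add_one _
      have hle : (k : ℝ) / n ≤ (t : ℝ) := by rw [div_le_iff₀ hnr]; exact h1
      have hlt : (t : ℝ) < ((k : ℝ) + 1) / n := by rw [lt_div_iff₀ hnr]; exact h2
      rw [abs_of_nonneg (by linarith)]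
      calc (t : ℝ) - k / n < ((k : ℝ) + 1) / n - k / n := by linarith
        _ = 1 / n := by ring
        _ < θ := hn'
    rcases hlink ht (ha k) (hmod hkt) with e' | hadj
    · rw [e']; exact (hchain k hkn).symm
    · exact (PathIn.of_adj (show e ∈ N from ⟨t, ht⟩) (haN k) hadj).trans (hchain k hkn).symm
  exact (hto c hc).trans (hto c' hc').symm

end Literature.Probability.Percolation
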